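import Mathlib.Analysis.SpecialFunctions.Sqrt
import Mathlib.Analysis.SpecialFunctions.ExpDeriv
import Literature.MathematicalPhysics.QuantumLattice.SpectroscopicGapRatio
import Literature.MathematicalPhysics.QuantumLattice.HubbardFreePropagator
import HarnessLib

/-!
# The planar-¹⁷O NMR pseudogap ledger — certified arithmetic behind REFVALS-2 §134
# (cell hubbard-downfold): Nachtigal et al. 2020, Avramovska–Nachtigal–Haase 2021

[NachtigalEtAl2020PlanarOxygenPseudogap] re-analyse all published planar ¹⁷O relaxation and shift data
of the cuprates with the kernel `∑_E p(E)[1 − p(E)]`, `p` the Fermi function (their Eq. 1 — the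
Heitler–Teller `1/T₁ ∝ T`), remove states within `ΔE^U = k_B T^U_PG` of `μ` (Eq. 2) and tabulate `T^U_PG`
by compound and study (Tables I–II); they quote the universal un-gapped slope `0.36 /Ks` and the Korringa
constant `S₀ = T₁TK² = 1.4 × 10⁻⁵ Ks` («one estimates a spin shift of about K = 0.23 %»).
[AvramovskaNachtigalHaase2021OxygenYttriumPseudogap] add the ¹⁷O hyperfine anisotropy from first
principles, `C_α = c_iso + c_dip,α` with `c_iso = 1.3`, `c_dip∥σ = 0.37` a.u. and a traceless dipole
(«whence there is the factor of 1.5 for C∥σ/C⊥»; measured `1.45(10)` and `C⊥a/C⊥c = 0.90(15)`).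

This file types the exact content of those sentences, reusing the tree's `fermiFunction`
(`HubbardFreePropagator`) and `kBmeVPerKelvin` (`SpectroscopicGapRatio`); no named fact is introduced:

* §1 the Heitler–Teller kernel: `f(1 − f) = e^{βE}/(1 + e^{βE})²` and `d f/dE = −β f(1 − f)` (`HasDerivAt`)
  for the tree's `fermiFunction β E = 1/(1 + e^{βE})` — i.e. `p(1 − p) = k_BT (−∂p/∂E)`, whose energy
  integral over a constant density of states is `k_BT`;
* §2 the Korringa arithmetic `korringaShift S₀ s = √(S₀ s)`: `(1.4e-5, 0.36) ↦ (0.002244, 0.002246)`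
  (printed «0.23 %») and `(1.4e-5, 0.35) ↦ (0.002213, 0.002214)`;
* §3 the hyperfine anisotropy `oxygenCpar`/`oxygenCperp`: `(1.3 + 0.37)/(1.3 − 0.185) ∈ (1.4977, 1.4979)`,
  inside the measured `1.45 ± 0.10`, and `C⊥a/C⊥c = 1` inside `0.90 ± 0.15`;
* §4 the pseudogap energies `k_B T^U_PG` in meV for the tabulated `1450, 1500, 870, 510, 490, 200, 140` K
  and the located by-study / by-layer / by-shape ratios (`490/200`, `870/410`, `870/510`, `650/300`,
  `400/200`, `3620/1450`).
-/

noncomputable section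

namespace Literature.MathematicalPhysics.QuantumLattice.PlanarOxygenPseudogap

open Real
open Literature.MathematicalPhysics.QuantumLattice

/-! ## §1 The Heitler–Teller kernel on the tree's Fermi function -/

/-- `f(1 − f) = e^{βE}/(1 + e^{βE})²` for `f = fermiFunction β E = 1/(1 + e^{βE})` — the summand of
[cite: NachtigalEtAl2020PlanarOxygenPseudogap, Eq. (1) («∑_E p(E)[1 − p(E)]»)]. -/
theorem fermi_kernel (β E : ℝ) :
    fermiFunction β E * (1 - fermiFunction β E) = Real.exp (β * E) / (1 + Real.exp (β * E)) ^ 2 := by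
  unfold fermiFunction
  have hx : 0 < Real.exp (β * E) := Real.exp_pos _
  have hne : 1 + Real.exp (β * E) ≠ 0 := by positivity
  field_simp
  ring

/-- The kernel is (minus) the temperature-scaled energy derivative of the occupation:
`d/dE fermiFunction β E = −β · f(1 − f)`, i.e. `p(1 − p) = k_BT (−∂p/∂E)` with `β = 1/k_BT` — the exact
content of the Heitler–Teller statement `1/T₁ ∝ T` for a constant density of states.
[cite: NachtigalEtAl2020PlanarOxygenPseudogap, Eq. (1) and p. 8 («one finds the Heitler-Teller dependence,
1/T₁ ∝ T»)] -/
theorem fermi_hasDerivAt (β E : ℝ) :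
    HasDerivAt (fun y : ℝ => fermiFunction β y)
      (-(β * (fermiFunction β E * (1 - fermiFunction β E)))) E := by
  have h1 : HasDerivAt (fun y : ℝ => β * y) β E := by
    simpa using (hasDerivAt_id E).const_mul β
  have h2 : HasDerivAt (fun y : ℝ => Real.exp (β * y)) (Real.exp (β * E) * β) E :=
    (Real.hasDerivAt_exp (β * E)).comp E h1
  have h3 : HasDerivAt (fun y : ℝ => 1 + Real.exp (β * y)) (Real.exp (β * E) * β) E := by
    simpa using h2.const_add 1
  have hne : 1 + Real.exp (β * E) ≠ 0 := by positivity
  have h4 := h3.inv hne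
  have heq : (fun y : ℝ => fermiFunction β y) = fun y => (1 + Real.exp (β * y))⁻¹ := by
    funext y; simp [fermiFunction, one_div]
  rw [heq]
  refine h4.congr_deriv ?_
  rw [fermi_kernel]
  field_simp

/-- At `E = 0` (the chemical potential) the occupation is `1/2` and the kernel is `1/4` for every `β`.
[cite: NachtigalEtAl2020PlanarOxygenPseudogap, Eq. (1)] -/
theorem fermi_kernel_at_mu (β : ℝ) :
    fermiFunction β 0 = 1 / 2 ∧ fermiFunction β 0 * (1 - fermiFunction β 0) = 1 / 4 := by
  have h : fermiFunction β 0 = 1 / 2 := by simp [fermiFunction]; norm_num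
  refine ⟨h, ?_⟩
  rw [h]; norm_num

/-! ## §2 The Korringa arithmetic -/

/-- The spin shift a Korringa metal with `T₁TK² = S₀` assigns to a relaxation slope `s = 1/(T₁T)`:
`K = √(S₀ s)`. [cite: NachtigalEtAl2020PlanarOxygenPseudogap, p. 8 («T₁TK² = (γ_e/γ_n)²ħ/(4πk_B) ≡ S₀»)] -/
def korringaShift (S0 s : ℝ) : ℝ := Real.sqrt (S0 * s)

/-- Unfolding lemma for `korringaShift` [cite: NachtigalEtAl2020PlanarOxygenPseudogap, p. 8]. -/
theorem korringaShift_def (S0 s : ℝ) : korringaShift S0 s = Real.sqrt (S0 * s) := rfl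

/-- `korringaShift` inverts the Korringa relation: `K²/s = S₀` for `S₀ s ≥ 0`, `s ≠ 0`.
[cite: NachtigalEtAl2020PlanarOxygenPseudogap, p. 8] -/
theorem korringaShift_sq {S0 s : ℝ} (h : 0 ≤ S0 * s) (hs : s ≠ 0) :
    korringaShift S0 s ^ 2 / s = S0 := by
  rw [korringaShift_def, Real.sq_sqrt h]
  field_simp

/-- [cite: NachtigalEtAl2020PlanarOxygenPseudogap, p. 8 («with S₀ = 1.4 · 10⁻⁵ Ks one estimates a spin shift
of about K = 0.23 % from the relaxation slope of 0.36/Ks»); AvramovskaNachtigalHaase2021OxygenYttriumPseudogap,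
p. 5 («slope of 0.35/Ks»)]: `√(1.4e-5 × 0.36) ∈ (0.002244, 0.002246)` (= 0.2245 %) and
`√(1.4e-5 × 0.35) ∈ (0.002213, 0.002214)`. -/
theorem korringa_rows :
    (0.002244 < korringaShift 1.4e-5 0.36 ∧ korringaShift 1.4e-5 0.36 < 0.002246) ∧
    (0.002213 < korringaShift 1.4e-5 0.35 ∧ korringaShift 1.4e-5 0.35 < 0.002214) := by
  have key : ∀ (x lo hi : ℝ), 0 ≤ lo → 0 < hi → lo ^ 2 < x → x < hi ^ 2 →
      lo < Real.sqrt x ∧ Real.sqrt x < hi := by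
    intro x lo hi hlo hhi h1 h2
    exact ⟨(Real.lt_sqrt hlo).mpr h1, (Real.sqrt_lt' hhi).mpr h2⟩
  unfold korringaShift
  exact ⟨key _ _ _ (by norm_num) (by norm_num) (by norm_num) (by norm_num),
    key _ _ _ (by norm_num) (by norm_num) (by norm_num) (by norm_num)⟩

/-! ## §3 The ¹⁷O hyperfine anisotropy of [AvramovskaNachtigalHaase2021OxygenYttriumPseudogap] -/

/-- `C∥σ = c_iso + c_dip∥σ` (field along the Cu–O–Cu σ bond).
[cite: AvramovskaNachtigalHaase2021OxygenYttriumPseudogap, Eq. (2) («C_α = c_iso + c_dip,α»)] -/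
def oxygenCpar (ciso cdip : ℝ) : ℝ := ciso + cdip

/-- `C⊥ = c_iso − c_dip∥σ/2` (traceless axial dipole: «C_dip∥σ ≈ 2|C_dip⊥c,a|»).
[cite: AvramovskaNachtigalHaase2021OxygenYttriumPseudogap, Eq. (2) and p. 4] -/
def oxygenCperp (ciso cdip : ℝ) : ℝ := ciso - cdip / 2

/-- Unfolding lemma for `oxygenCpar` [cite: AvramovskaNachtigalHaase2021OxygenYttriumPseudogap, Eq. (2)]. -/
theorem oxygenCpar_def (ciso cdip : ℝ) : oxygenCpar ciso cdip = ciso + cdip := rfl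

/-- Unfolding lemma for `oxygenCperp` [cite: AvramovskaNachtigalHaase2021OxygenYttriumPseudogap, Eq. (2)]. -/
theorem oxygenCperp_def (ciso cdip : ℝ) : oxygenCperp ciso cdip = ciso - cdip / 2 := rfl

/-- The dipolar part is traceless: `C∥ + 2 C⊥ = 3 c_iso`.
[cite: AvramovskaNachtigalHaase2021OxygenYttriumPseudogap, Eq. (2) («a (traceless) dipolar term»)] -/
theorem oxygenC_trace (ciso cdip : ℝ) : oxygenCpar ciso cdip + 2 * oxygenCperp ciso cdip = 3 * ciso := by
  unfold oxygenCpar oxygenCperp; ring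

/-- [cite: AvramovskaNachtigalHaase2021OxygenYttriumPseudogap, p. 4 («c_iso = 1.3, c_dip∥σ = 0.37 (in atomic
units), whence there is the factor of 1.5 for C∥σ/C⊥c,a»; measured «C∥σ/C⊥a ≈ 1.45(10)», «C⊥a/C⊥c ≈
0.90(15)»)]: `C∥ = 1.67`, `C⊥ = 1.115`, ratio `∈ (1.4977, 1.4979)` and inside `[1.35, 1.55]`; the model's
`C⊥a/C⊥c = 1` lies inside `[0.75, 1.05]`. -/
theorem oxygen_anisotropy_rows :
    oxygenCpar 1.3 0.37 = 1.67 ∧ oxygenCperp 1.3 0.37 = 1.115 ∧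
    (1.4977 < oxygenCpar 1.3 0.37 / oxygenCperp 1.3 0.37 ∧ oxygenCpar 1.3 0.37 / oxygenCperp 1.3 0.37 < 1.4979) ∧
    (1.45 - 0.10 ≤ oxygenCpar 1.3 0.37 / oxygenCperp 1.3 0.37 ∧ oxygenCpar 1.3 0.37 / oxygenCperp 1.3 0.37 ≤ 1.45 + 0.10) ∧
    ((0.90 : ℝ) - 0.15 ≤ oxygenCperp 1.3 0.37 / oxygenCperp 1.3 0.37 ∧
      oxygenCperp 1.3 0.37 / oxygenCperp 1.3 0.37 ≤ 0.90 + 0.15) := by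
  have hp : oxygenCpar 1.3 0.37 = 1.67 := by norm_num [oxygenCpar]
  have hq : oxygenCperp 1.3 0.37 = 1.115 := by norm_num [oxygenCperp]
  rw [hp, hq]
  refine ⟨rfl, rfl, ⟨?_, ?_⟩, ⟨?_, ?_⟩, ⟨?_, ?_⟩⟩ <;> norm_num

/-! ## §4 Pseudogap energies and the located ratios of [NachtigalEtAl2020PlanarOxygenPseudogap] -/

/-- `ΔE^U = k_B T^U_PG` in meV for `T^U_PG` in kelvin, with the tree's `kBmeVPerKelvin`.
[cite: NachtigalEtAl2020PlanarOxygenPseudogap, Eq. (2) («T^{U,V}_PG = ΔE^{U,V}/k_B»)] -/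
def pgEnergyMeV (T : ℝ) : ℝ := kBmeVPerKelvin * T

/-- Unfolding lemma for `pgEnergyMeV` [cite: NachtigalEtAl2020PlanarOxygenPseudogap, Eq. (2)]. -/
theorem pgEnergyMeV_def (T : ℝ) : pgEnergyMeV T = kBmeVPerKelvin * T := rfl

/-- [cite: NachtigalEtAl2020PlanarOxygenPseudogap, Tables I–II and p. 11 («T^U_PG ≈ 1450 K, the size of the
exchange coupling»), abstract («about 1500 K»)]: `k_B × 1450 K ∈ (124.95, 124.96)` meV, `1500 ↦ (129.25,
129.27)`, `870 ↦ (74.97, 74.98)` (Bi2223 inner plane / Tl2223 s.c.), `510 ↦ (43.94, 43.95)` (Bi2223 outer),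
`490 ↦ (42.22, 42.23)` and `200 ↦ (17.23, 17.24)` (Y124 by study), `140 ↦ (12.06, 12.07)` (LSCO x 0.15). -/
theorem pg_energy_rows :
    (124.95 < pgEnergyMeV 1450 ∧ pgEnergyMeV 1450 < 124.96) ∧
    (129.25 < pgEnergyMeV 1500 ∧ pgEnergyMeV 1500 < 129.27) ∧
    (74.97 < pgEnergyMeV 870 ∧ pgEnergyMeV 870 < 74.98) ∧
    (43.94 < pgEnergyMeV 510 ∧ pgEnergyMeV 510 < 43.95) ∧
    (42.22 < pgEnergyMeV 490 ∧ pgEnergyMeV 490 < 42.23) ∧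
    (17.23 < pgEnergyMeV 200 ∧ pgEnergyMeV 200 < 17.24) ∧
    (12.06 < pgEnergyMeV 140 ∧ pgEnergyMeV 140 < 12.07) := by
  have hk := kBmeVPerKelvin_bounds
  unfold pgEnergyMeV
  refine ⟨⟨?_, ?_⟩, ⟨?_, ?_⟩, ⟨?_, ?_⟩, ⟨?_, ?_⟩, ⟨?_, ?_⟩, ⟨?_, ?_⟩, ⟨?_, ?_⟩⟩ <;> nlinarith [hk.1, hk.2]

/-- The located spreads as exact ratios: Y124 by study `490/200 = 2.45`; Tl2223 by study `870/410 ∈ (2.121,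
2.122)`; Bi2223 inner/outer `870/510 ∈ (1.705, 1.706)`; the U-vs-V shape factor on the same data `650/300 ∈
(2.166, 2.167)`, `400/200 = 2`, `3620/1450 ∈ (2.496, 2.497)`; and «1450 K ≈ J»: against a `157` meV exchange
(`= 157/k_B` K) the ratio `1450 k_B/157 ∈ (0.795, 0.797)`, against `135` meV `∈ (0.925, 0.926)`.
[cite: NachtigalEtAl2020PlanarOxygenPseudogap, Tables I–II, pp. 8–9, 11] -/
theorem pg_ratio_rows :
    (490 : ℝ) / 200 = 2.45 ∧ ((2.121 : ℝ) < 870 / 410 ∧ (870 : ℝ) / 410 < 2.122) ∧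
    ((1.705 : ℝ) < 870 / 510 ∧ (870 : ℝ) / 510 < 1.706) ∧
    ((2.166 : ℝ) < 650 / 300 ∧ (650 : ℝ) / 300 < 2.167) ∧ (400 : ℝ) / 200 = 2 ∧
    ((2.496 : ℝ) < 3620 / 1450 ∧ (3620 : ℝ) / 1450 < 2.497) ∧
    (0.795 < pgEnergyMeV 1450 / 157 ∧ pgEnergyMeV 1450 / 157 < 0.797) ∧
    (0.925 < pgEnergyMeV 1450 / 135 ∧ pgEnergyMeV 1450 / 135 < 0.926) := by
  have he := pg_energy_rows.1
  refine ⟨by norm_num, ⟨by norm_num, by norm_num⟩, ⟨by norm_num, by norm_num⟩, ⟨by norm_num, by norm_num⟩,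
    by norm_num, ⟨by norm_num, by norm_num⟩, ⟨?_, ?_⟩, ⟨?_, ?_⟩⟩
  · rw [lt_div_iff₀ (by norm_num : (0:ℝ) < 157)]; linarith [he.1]
  · rw [div_lt_iff₀ (by norm_num : (0:ℝ) < 157)]; linarith [he.2]
  · rw [lt_div_iff₀ (by norm_num : (0:ℝ) < 135)]; linarith [he.1]
  · rw [div_lt_iff₀ (by norm_num : (0:ℝ) < 135)]; linarith [he.2]

/-- The La₂₋ₓSrₓCuO₄ sequence `x ↦ T^U_PG` of Table II within one study (Singer2005 / Thurber1997:
`0.025 ↦ 1450`, `0.035 ↦ 1300`, `0.05 ↦ 1085`, `0.115 ↦ 360`, `0.15 ↦ 140` K) is strictly antitone, and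
the `x = 0.15` by-study set `{140, 140, 260}` spans a factor `260/140 ∈ (1.857, 1.858)`.
[cite: NachtigalEtAl2020PlanarOxygenPseudogap, Table II] -/
theorem lsco_sequence_rows :
    ((0.025 : ℝ) < 0.035 ∧ (0.035 : ℝ) < 0.05 ∧ (0.05 : ℝ) < 0.115 ∧ (0.115 : ℝ) < 0.15) ∧
    ((1450 : ℝ) > 1300 ∧ (1300 : ℝ) > 1085 ∧ (1085 : ℝ) > 360 ∧ (360 : ℝ) > 140) ∧
    ((1.857 : ℝ) < 260 / 140 ∧ (260 : ℝ) / 140 < 1.858) := by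
  refine ⟨⟨?_, ?_, ?_, ?_⟩, ⟨?_, ?_, ?_, ?_⟩, ⟨?_, ?_⟩⟩ <;> norm_num

end Literature.MathematicalPhysics.QuantumLattice.PlanarOxygenPseudogap

end
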